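import Literature.InformationTheory.QuantumCodes.HypergraphProductThresholds
import Literature.InformationTheory.QuantumCodes.HypergraphProductDimension
import Literature.InformationTheory.QuantumCodes.CSS
import Literature.InformationTheory.Coding.GoodLDPCCodesExist
import HarnessLib

/-!
# A positive-rate quantum LDPC family with a CERTIFIED threshold, unconditionally: the hypergraph product
# of Gallager's good classical LDPC codes (Tillich–Zémor Theorem 1) under the Dumer–Kovalev–Pryadko bound

Topic `Literature/InformationTheory/QuantumCodes` (venture QEC, LADDER-QEC rung Q5 × "LDPC families beyond the
toric code"; qec-lit-2 gen 3). PROVED end-to-end, NO named fact, kernel axioms: the tree PROVES that good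
classical LDPC codes exist (`Coding.exists_goodLDPCMatrix_minDist`: for every `n ≥ 1` a FULL-RANK `r × 2n` binary
matrix `H`, `8r ≤ 15n`, row weights `≤ 8`, column weights `≤ 4`, `d(ker H) ≥ ⌊n/650⌋ + 1`), PROVES
Tillich–Zémor's Theorems 7 and 9 (`HypergraphProduct.dimension_eq_holds`, `min_le_hammingNorm_of_cycle`) and
PROVES the cluster-expansion thresholds (`HypergraphProductThresholds.lean`). Choosing one Gallager matrix `G_j`
for each `n_j = 650(j+1)` (by `Classical.choose` — the family EXISTS, it is not explicit) and forming
`HGP(G_j, G_jᵀ)` (TZ Thm 1: "length `N = n² + (n-k)²`, dimension `k²`, and quantum minimum distance `d`")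
gives a quantum LDPC family with

* `N_j = (2n_j)² + r_j² ≤ 8 n_j²` qubits, `X`-checks of weight `≤ 8 + 4 = 12` (`card_rowSupp_gallagerHX_le`),
* distance of the `H_X`-detected sector `≥ j + 2` (`le_hammingNorm_of_gallager_cycle`; `d(ker Gᵀ) = ∞` by full
  rank, `pcCode_transpose_eq_bot_of_rank_eq`),
* `k ≥ 1` logical qubits — in fact `k = (2n_j - r_j)² ≥ (n_j/8)²`, positive RATE `≥ 1/512` — and a non-trivial
  logical in this sector (`gallager_k_pos`, `gallager_exists_logical`: NON-VACUITY),

and therefore (DKP15 with `w = 12`) the CERTIFIED thresholds `gallagerHGP_codeCapacityThreshold`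
(`4·11²·p(1-p) < 1`, i.e. `p < p₀(11) ≈ .00207`, every minimum-weight decoder family),
`gallagerHGP_erasureThreshold` (`y < 1/11`), `gallagerHGP_phenomThreshold` (`4·13²·p(1-p) < 1`, `q = p`,
polynomially many rounds), and the SECOND SECTOR (`H_Z`-detected errors: `card_rowSupp_gallagerHZ_le`,
`le_hammingNorm_of_gallager_cocycle`, `gallager_exists_logical'`, `gallagerHGP_codeCapacityThreshold'`,
`gallagerHGP_erasureThreshold'`). This is the first certified threshold in the tree for a POSITIVE-RATE family.

## References

* [TillichZemor2014] J.-P. Tillich, G. Zémor, IEEE Trans. IT 60 (2014) 1193, Thm 1, Thm 7, Thm 9.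
* [Gallager1963] R. G. Gallager, *Low-Density Parity-Check Codes*, MIT Press 1963, Ch. 2 (via the tree's proof).
* [DumerKovalevPryadko2015] I. Dumer, A. A. Kovalev, L. P. Pryadko, PRL 115 (2015) 050502, Thm 2, Thm 3.
-/

noncomputable section

namespace Literature.InformationTheory.QuantumCodes

open Finset Matrix Filter Topology
open Literature.InformationTheory.Coding (exists_goodLDPCMatrix_minDist)

/-! ### Full row rank kills the transpose code -/

/-- If an `r`-rowed binary matrix has rank `r` (= `|R|`), the code with parity-check matrix `Hᵀ` is zero:
`ker Hᵀ = 0`, so `d(ker Hᵀ) = ∞` in Tillich–Zémor's Theorem 9 ("`𝐇` … a full-rank matrix").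
[cite: TillichZemor2014, Thm 1 (full-rank parity-check matrix) with §5 (distance of the zero code is ∞)] -/
theorem pcCode_transpose_eq_bot_of_rank_eq {R Q : Type*} [Fintype R] [Fintype Q] [DecidableEq R] [DecidableEq Q]
    (H : Matrix R Q (ZMod 2)) (hH : H.rank = Fintype.card R) : pcCode Hᵀ = ⊥ := by
  have h := rank_add_finrank_pcCode Hᵀ
  rw [Matrix.rank_transpose, hH] at h
  have h0 : Module.finrank (ZMod 2) (pcCode Hᵀ) = 0 := by omega
  exact Submodule.finrank_eq_zero.1 h0

/-! ### The Gallager matrices (chosen) -/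

/-- Block-length parameter of the `j`-th member: `n_j = 650 (j+1)` (so that `⌊n_j/650⌋ + 1 = j + 2`).
[cite: Gallager1963, Ch. 2 (block length n of the ensemble)] -/
def gallagerN (j : ℕ) : ℕ := 650 * (j + 1)

/-- `n_j ≥ 1`. [cite: Gallager1963, Ch. 2] -/
theorem one_le_gallagerN (j : ℕ) : 1 ≤ gallagerN j := by
  unfold gallagerN; omega

/-- The number of checks `r_j` of the chosen Gallager matrix. [cite: Gallager1963, Ch. 2 (the ensemble's parity checks)] -/
def gallagerR (j : ℕ) : ℕ := Classical.choose (exists_goodLDPCMatrix_minDist (one_le_gallagerN j))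

/-- The chosen Gallager matrix `G_j : 𝔽₂^{r_j × 2 n_j}` (full rank, `8 r_j ≤ 15 n_j`, rows `≤ 8`, columns
`≤ 4`, `d(ker G_j) ≥ ⌊n_j/650⌋ + 1`). [cite: Gallager1963, Ch. 2 (a code of the ensemble with linear minimum distance)] -/
def gallagerMatrix (j : ℕ) : Matrix (Fin (gallagerR j)) (Fin (2 * gallagerN j)) (ZMod 2) :=
  Classical.choose (Classical.choose_spec (exists_goodLDPCMatrix_minDist (one_le_gallagerN j)))

/-- The defining properties of `G_j`. [cite: Gallager1963, Ch. 2 (with SipserSpielman1996 Thm 7, as proved in the tree)] -/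
theorem gallagerMatrix_spec (j : ℕ) :
    (gallagerMatrix j).rank = gallagerR j ∧ 8 * gallagerR j ≤ 15 * gallagerN j ∧
      (∀ i, hammingNorm (gallagerMatrix j i) ≤ 8) ∧ (∀ c, hammingNorm (fun i => gallagerMatrix j i c) ≤ 4) ∧
      ((gallagerN j / 650 + 1 : ℕ) : ℕ∞) ≤ Coding.minDist (LinearMap.ker (gallagerMatrix j).mulVecLin) :=
  Classical.choose_spec (Classical.choose_spec (exists_goodLDPCMatrix_minDist (one_le_gallagerN j)))

/-- `⌊n_j/650⌋ + 1 = j + 2`. [cite: Gallager1963, Ch. 2] -/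
theorem gallagerN_div (j : ℕ) : gallagerN j / 650 + 1 = j + 2 := by
  unfold gallagerN; omega

/-! ### The quantum family `HGP(G_j, G_jᵀ)` -/

/-- Qubits of the `j`-th member: `(E₁ × V₂) ⊕ (V₁ × E₂)` with `E₁ = V₂ = Fin (2n_j)`, `V₁ = E₂ = Fin r_j`
(`N = (2n)² + r²`, TZ Thm 1's `n² + (n-k)²` for the `[2n, 2n-r]` code).
[cite: TillichZemor2014, Thm 1 (length N = n² + (n−k)²)] -/
abbrev GallagerQubit (j : ℕ) : Type :=
  (Fin (2 * gallagerN j) × Fin (2 * gallagerN j)) ⊕ (Fin (gallagerR j) × Fin (gallagerR j))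

/-- `X`-checks of the `j`-th member (`V₁ × V₂`). [cite: TillichZemor2014, §3-§4] -/
abbrev GallagerCheck (j : ℕ) : Type := Fin (gallagerR j) × Fin (2 * gallagerN j)

/-- `H_X` of `HGP(G_j, G_jᵀ)`. [cite: TillichZemor2014, Thm 1 and §4 (H_X of the product)] -/
def gallagerHX (j : ℕ) : Matrix (GallagerCheck j) (GallagerQubit j) (ZMod 2) :=
  HypergraphProduct.xMatrix (gallagerMatrix j) (gallagerMatrix j)ᵀ

/-- `H_Z` of `HGP(G_j, G_jᵀ)`. [cite: TillichZemor2014, Thm 1 and §4 (H_Z of the product)] -/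
def gallagerHZ (j : ℕ) : Matrix (Fin (2 * gallagerN j) × Fin (gallagerR j)) (GallagerQubit j) (ZMod 2) :=
  HypergraphProduct.zMatrix (gallagerMatrix j) (gallagerMatrix j)ᵀ

/-- The trivial errors of the `H_X`-detected sector: `rowsp H_Z`. [cite: TillichZemor2014, §3-§4] -/
def gallagerSZ (j : ℕ) : Submodule (ZMod 2) (GallagerQubit j → ZMod 2) :=
  rowSpace (gallagerHZ j)

/-- **Check weight `≤ 12`** ("row weights of the form `i + j`": `8` from a row of `G`, `4` from a column).
[cite: TillichZemor2014, Thm 1 (row weights i + j)] -/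
theorem card_rowSupp_gallagerHX_le (j : ℕ) (x : GallagerCheck j) : (rowSupp (gallagerHX j) x).card ≤ 12 :=
  HypergraphProduct.card_rowSupp_xMatrix_le _ _ (gallagerMatrix_spec j).2.2.1
    (fun b => (gallagerMatrix_spec j).2.2.2.1 b) x

/-- **Distance `≥ j + 2`** of the `H_X`-detected sector (TZ Thm 9: `min(d(ker G), d(ker Gᵀ)) = min(j+2, ∞)`).
[cite: TillichZemor2014, Thm 1 ("quantum minimum distance d") via Thm 9] -/
theorem le_hammingNorm_of_gallager_cycle (j : ℕ) (x : GallagerQubit j → ZMod 2) (hx : gallagerHX j *ᵥ x = 0)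
    (hxS : x ∉ gallagerSZ j) : j + 2 ≤ hammingNorm x := by
  have hspec := gallagerMatrix_spec j
  refine HypergraphProduct.le_hammingNorm_of_cycle _ _ ?_ ?_ x hx hxS
  · have h := hspec.2.2.2.2
    rw [gallagerN_div] at h
    exact h
  · rw [pcCode_transpose_eq_bot_of_rank_eq _ (by rw [hspec.1, Fintype.card_fin]), Coding.minDist_bot]
    exact le_top

/-- The number of qubits: `N_j = (2n_j)² + r_j²`. [cite: TillichZemor2014, Thm 1 (N = n² + (n−k)²)] -/
theorem card_gallagerQubit (j : ℕ) :
    Fintype.card (GallagerQubit j) = (2 * gallagerN j) ^ 2 + gallagerR j ^ 2 := by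
  simp only [Fintype.card_sum, Fintype.card_prod, Fintype.card_fin]
  ring

/-- `N_j ≤ 8 n_j²` (since `r_j ≤ 15 n_j / 8 ≤ 2 n_j`). [cite: TillichZemor2014, Thm 1] -/
theorem card_gallagerQubit_le (j : ℕ) : Fintype.card (GallagerQubit j) ≤ 8 * gallagerN j ^ 2 := by
  rw [card_gallagerQubit]
  have h := (gallagerMatrix_spec j).2.1
  have hr : gallagerR j ≤ 2 * gallagerN j := by omega
  have h2 : gallagerR j ^ 2 ≤ (2 * gallagerN j) ^ 2 := Nat.pow_le_pow_left hr 2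
  nlinarith

/-- The number of `X`-checks: `r_j · 2n_j ≤ 4 n_j²`. [cite: TillichZemor2014, §4] -/
theorem card_gallagerCheck_le (j : ℕ) : Fintype.card (GallagerCheck j) ≤ 4 * gallagerN j ^ 2 := by
  simp only [Fintype.card_prod, Fintype.card_fin]
  have h := (gallagerMatrix_spec j).2.1
  nlinarith

/-! ### Non-vacuity: positive dimension and a logical operator -/

/-- The CSS code of the `j`-th member. [cite: TillichZemor2014, Prop. 3 (C_X^⊥ ⊥ C_Z^⊥)] -/
def gallagerCSS (j : ℕ) : CSSCode (GallagerCheck j) (Fin (2 * gallagerN j) × Fin (gallagerR j)) (GallagerQubit j) :=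
  CSSCode.ofMatrices (gallagerHX j) (gallagerHZ j) (HypergraphProduct.xMatrix_mul_zMatrix_transpose _ _)

/-- **TZ Theorem 7 for the family: `k = (2n_j - r_j)²`** (the classical code `ker G_j` has dimension
`2n_j - r_j`; `ker G_jᵀ = 0`). [cite: TillichZemor2014, Thm 1 (dimension k²) via Thm 7] -/
theorem gallager_k_eq (j : ℕ) : (gallagerCSS j).k = (2 * gallagerN j - gallagerR j) ^ 2 := by
  have hspec := gallagerMatrix_spec j
  have hdim := (HypergraphProduct.dimension_eq_holds _ _ _ _ (gallagerMatrix j) (gallagerMatrix j)ᵀ).2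
  -- the classical dimensions
  have hk1 : Module.finrank (ZMod 2) (pcCode (gallagerMatrix j)) = 2 * gallagerN j - gallagerR j := by
    have h := rank_add_finrank_pcCode (gallagerMatrix j)
    rw [hspec.1, Fintype.card_fin] at h
    omega
  have hk2 : Module.finrank (ZMod 2) (pcCode (gallagerMatrix j)ᵀ) = 0 := by
    rw [pcCode_transpose_eq_bot_of_rank_eq _ (by rw [hspec.1, Fintype.card_fin]), finrank_bot]
  rw [hk1, hk2, Fintype.card_fin, Fintype.card_fin] at hdim
  have hr : gallagerR j ≤ 2 * gallagerN j := by have := hspec.2.1; omega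
  have hle := (gallagerCSS j).rank_HX_add_rank_HZ_le
  have hkeq := (gallagerCSS j).k_eq
  -- compare the `ℤ` identity with the `ℕ` formula
  have hX : (gallagerCSS j).HX = gallagerHX j := rfl
  have hZ : (gallagerCSS j).HZ = gallagerHZ j := rfl
  rw [hX, hZ] at hkeq hle
  have hcast : ((Fintype.card (GallagerQubit j) - (gallagerHX j).rank - (gallagerHZ j).rank : ℕ) : ℤ) =
      (Fintype.card (GallagerQubit j) : ℤ) - (gallagerHX j).rank - (gallagerHZ j).rank := by
    push_cast [Nat.sub_sub]
    rw [Nat.cast_sub hle]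
    push_cast
    ring
  have hfinal : ((gallagerCSS j).k : ℤ) = ((2 * gallagerN j - gallagerR j) ^ 2 : ℕ) := by
    rw [hkeq, hcast]
    unfold gallagerHX gallagerHZ
    rw [hdim]
    push_cast [Nat.cast_sub hr]
    ring
  exact_mod_cast hfinal

/-- **Positive dimension** (`k ≥ (n_j/8)² ≥ 1`). [cite: TillichZemor2014, Thm 1 (dimension k² with k ≥ n/16 · …)] -/
theorem gallager_k_pos (j : ℕ) : 0 < (gallagerCSS j).k := by
  rw [gallager_k_eq]
  have h := (gallagerMatrix_spec j).2.1
  have h1 : 1 ≤ gallagerN j := one_le_gallagerN j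
  have : 0 < 2 * gallagerN j - gallagerR j := by omega
  positivity

/-- **Non-vacuity**: the `H_X`-detected sector has a non-trivial logical operator (`d^Z > 0` since `k > 0`).
[cite: TillichZemor2014, Thm 1 via Thm 7 (k² > 0)] -/
theorem gallager_exists_logical (j : ℕ) :
    ∃ x : GallagerQubit j → ZMod 2, gallagerHX j *ᵥ x = 0 ∧ x ∉ gallagerSZ j := by
  have hk := gallager_k_pos j
  have hdX : (gallagerCSS j).dX ≠ 0 := fun h => (Nat.pos_iff_ne_zero.1 hk) (((gallagerCSS j).k_eq_zero_iff_dX_eq_zero).2 h)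
  have hdZ : 0 < (gallagerCSS j).dZ :=
    Nat.pos_of_ne_zero fun h => hdX (((gallagerCSS j).dX_eq_zero_iff_dZ_eq_zero).2 h)
  obtain ⟨v, hv, hv'⟩ := ((gallagerCSS j).dZ_pos_iff).1 hdZ
  exact ⟨v, hv, hv'⟩

/-! ### The certified thresholds -/

/-- Polynomial size times geometric decay tends to `0`. [cite: DennisEtAl2002, §5.3 (L² μ^L (4p̃)^{L/2} → 0)] -/
private theorem tendsto_poly_mul_pow' {r : ℝ} (hr0 : 0 < r) (hr1 : r < 1) (A : ℝ) (m : ℕ) :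
    Tendsto (fun k : ℕ => A * ((k : ℝ) + 2) ^ m * r ^ (k + 2)) atTop (𝓝 0) := by
  have h0 := tendsto_pow_const_mul_const_pow_of_abs_lt_one m
    (show |r| < 1 by rwa [abs_of_nonneg hr0.le])
  have h1 : Tendsto (fun k : ℕ => ((k + 2 : ℕ) : ℝ) ^ m * r ^ (k + 2)) atTop (𝓝 0) :=
    (Filter.tendsto_add_atTop_iff_nat 2).2 h0
  have h2 := h1.const_mul A
  rw [mul_zero] at h2
  refine h2.congr fun k => ?_
  push_cast
  ring

/-- `n_j ≤ 650 (j+2)` as reals. [cite: Gallager1963, Ch. 2] -/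
theorem gallagerN_le_real (j : ℕ) : (gallagerN j : ℝ) ≤ 650 * ((j : ℝ) + 2) := by
  unfold gallagerN
  push_cast
  linarith

/-- `N_j ≤ 8·650² (j+2)²` as reals. [cite: TillichZemor2014, Thm 1] -/
theorem card_gallagerQubit_le_real (j : ℕ) :
    (Fintype.card (GallagerQubit j) : ℝ) ≤ 8 * 650 ^ 2 * ((j : ℝ) + 2) ^ 2 := by
  have h := card_gallagerQubit_le j
  have h' : (Fintype.card (GallagerQubit j) : ℝ) ≤ 8 * (gallagerN j : ℝ) ^ 2 := by exact_mod_cast h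
  have hn2 : (gallagerN j : ℝ) ^ 2 ≤ (650 * ((j : ℝ) + 2)) ^ 2 :=
    pow_le_pow_left₀ (Nat.cast_nonneg _) (gallagerN_le_real j) 2
  calc (Fintype.card (GallagerQubit j) : ℝ) ≤ 8 * (gallagerN j : ℝ) ^ 2 := h'
    _ ≤ 8 * (650 * ((j : ℝ) + 2)) ^ 2 := by linarith
    _ = 8 * 650 ^ 2 * ((j : ℝ) + 2) ^ 2 := by ring

open Classical in
/-- **Certified code-capacity threshold of a positive-rate quantum LDPC family** (the hypergraph products of
Gallager's good classical LDPC codes; EVERY family of minimum-weight decoders of the `H_X`-detected sector):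
`4·11²·p(1-p) < 1` (`p < p₀(11) ≈ .00207`) ⇒ `Prob_fail → 0`. UNCONDITIONAL, no named fact.
[cite: DumerKovalevPryadko2015, Thm 2 (y = 0; w = 12)] -/
theorem gallagerHGP_codeCapacityThreshold
    (D : ∀ j, Decoder (GallagerCheck j → ZMod 2) (GallagerQubit j → ZMod 2))
    (hD : ∀ j, (D j).IsMinWeight (fun e => gallagerHX j *ᵥ e) {x | gallagerHX j *ᵥ x = 0} hammingNorm)
    {p : ℝ} (hp0 : 0 ≤ p) (hp : p ≤ 1 / 2) (h : 484 * (p * (1 - p)) < 1) :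
    Tendsto (fun j => ∑ e ∈ univ.filter (fun e : GallagerQubit j → ZMod 2 =>
        ¬ (D j).Corrects (fun e => gallagerHX j *ᵥ e) (gallagerSZ j : Set (GallagerQubit j → ZMod 2)) e),
        bernoulliWeight p (supp e)) atTop (𝓝 0) := by
  refine codeCapacityThreshold_of_rowWeight' gallagerHX gallagerSZ D hD (w := 12) (by norm_num)
    card_rowSupp_gallagerHX_le (fun j => j + 2) (fun j => by omega) le_hammingNorm_of_gallager_cycle ?_ hp0 hp
    (by norm_num; linarith)
  intro r hr0 hr1
  have hl := tendsto_poly_mul_pow' hr0 hr1 (8 * 650 ^ 2) 2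
  refine squeeze_zero (fun j => by positivity) (fun j => ?_) hl
  exact mul_le_mul_of_nonneg_right (card_gallagerQubit_le_real j) (pow_nonneg hr0.le _)

/-- **Certified erasure threshold `≥ 1/11`** of the same family. UNCONDITIONAL.
[cite: DumerKovalevPryadko2015, Thm 2 (erasure part; w = 12)] -/
theorem gallagerHGP_erasureThreshold {y : ℝ} (hy0 : 0 ≤ y) (hy : 11 * y < 1) :
    Tendsto (fun j => ErasureDecoder.uncorrectableProb {x : GallagerQubit j → ZMod 2 | gallagerHX j *ᵥ x = 0}
      (gallagerSZ j : Set (GallagerQubit j → ZMod 2)) y) atTop (𝓝 0) := by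
  refine erasureThreshold_of_rowWeight' gallagerHX gallagerSZ (w := 12) (by norm_num) card_rowSupp_gallagerHX_le
    (fun j => j + 2) (fun j => by omega) le_hammingNorm_of_gallager_cycle ?_ hy0 (by norm_num; linarith)
  intro r hr0 hr1
  have hl := tendsto_poly_mul_pow' hr0 hr1 (8 * 650 ^ 2) 2
  refine squeeze_zero (fun j => by positivity) (fun j => ?_) hl
  exact mul_le_mul_of_nonneg_right (card_gallagerQubit_le_real j) (pow_nonneg hr0.le _)

/-- **Certified phenomenological threshold** (`q = p`, polynomially many rounds, every minimum-weight
space-time decoder family): `4·13²·p(1-p) < 1` ⇒ `Prob_fail → 0`. UNCONDITIONAL.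
[cite: DumerKovalevPryadko2015, Thm 3 with p. 5 (w → w + 2; here 12 → 14)] -/
theorem gallagerHGP_phenomThreshold (T : ℕ → ℕ) (hT : ToricCode.IsPolyBounded T)
    (D : ∀ j, CSSPhenom.STDecoder (GallagerCheck j) (GallagerQubit j) (T j))
    (hD : ∀ j, (D j).IsMinWeight (CSSPhenom.stSyn (gallagerHX j) (T j))
      (CSSPhenom.stCycles (gallagerHX j) (T j)) hammingNorm)
    {p : ℝ} (hp0 : 0 ≤ p) (hp : p ≤ 1 / 2) (h : 676 * (p * (1 - p)) < 1) :
    Tendsto (fun j => CSSPhenom.phenomFailureProb (gallagerHX j) (T j)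
      (gallagerSZ j : Set (GallagerQubit j → ZMod 2)) (D j) p p) atTop (𝓝 0) := by
  refine phenomThreshold_of_rowWeight' gallagerHX gallagerSZ T D hD (w := 12) card_rowSupp_gallagerHX_le
    (fun j => j + 2) (fun j => by omega) le_hammingNorm_of_gallager_cycle ?_ hp0 hp (by norm_num; linarith)
  intro r hr0 hr1
  obtain ⟨A, m, hAm⟩ := hT
  have hA0 : 0 ≤ A := by
    have h := hAm 0
    simp only [Nat.cast_zero, zero_add, one_pow, mul_one] at h
    exact le_trans (Nat.cast_nonneg _) h
  have hl := tendsto_poly_mul_pow' hr0 hr1 (12 * 650 ^ 2 * A) (m + 2)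
  refine squeeze_zero (fun j => by positivity) (fun j => ?_) hl
  have hrk : 0 ≤ r ^ (j + 2) := pow_nonneg hr0.le _
  refine mul_le_mul_of_nonneg_right ?_ hrk
  have hQ := card_gallagerQubit_le_real j
  have hC : (Fintype.card (GallagerCheck j) : ℝ) ≤ 4 * 650 ^ 2 * ((j : ℝ) + 2) ^ 2 := by
    have h := card_gallagerCheck_le j
    have h' : (Fintype.card (GallagerCheck j) : ℝ) ≤ 4 * (gallagerN j : ℝ) ^ 2 := by exact_mod_cast h
    have hn2 : (gallagerN j : ℝ) ^ 2 ≤ (650 * ((j : ℝ) + 2)) ^ 2 :=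
      pow_le_pow_left₀ (Nat.cast_nonneg _) (gallagerN_le_real j) 2
    calc (Fintype.card (GallagerCheck j) : ℝ) ≤ 4 * (gallagerN j : ℝ) ^ 2 := h'
      _ ≤ 4 * (650 * ((j : ℝ) + 2)) ^ 2 := by linarith
      _ = 4 * 650 ^ 2 * ((j : ℝ) + 2) ^ 2 := by ring
  have hTj := hAm j
  have hk1 : ((j : ℝ) + 1) ^ m ≤ ((j : ℝ) + 2) ^ m := pow_le_pow_left₀ (by positivity) (by linarith) m
  have hTj' : (T j : ℝ) ≤ A * ((j : ℝ) + 2) ^ m := hTj.trans (mul_le_mul_of_nonneg_left hk1 hA0)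
  have hT0 : 0 ≤ (T j : ℝ) := Nat.cast_nonneg _
  push_cast
  calc ((Fintype.card (GallagerQubit j) : ℝ) + (Fintype.card (GallagerCheck j) : ℝ)) * (T j : ℝ)
      ≤ (12 * 650 ^ 2 * ((j : ℝ) + 2) ^ 2) * (A * ((j : ℝ) + 2) ^ m) :=
        mul_le_mul (by linarith) hTj' hT0 (by positivity)
    _ = 12 * 650 ^ 2 * A * ((j : ℝ) + 2) ^ (m + 2) := by ring

/-! ### The second sector (errors detected by `H_Z`, trivial iff in `rowsp H_X`) -/

/-- `Z`-checks (chambers `E₁ × E₂ = Fin (2n) × Fin r`) of the `j`-th member. [cite: TillichZemor2014, §3] -/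
abbrev GallagerZCheck (j : ℕ) : Type := Fin (2 * gallagerN j) × Fin (gallagerR j)

/-- The trivial errors of the second sector: `rowsp H_X`. [cite: TillichZemor2014, §3-§4] -/
def gallagerSX (j : ℕ) : Submodule (ZMod 2) (GallagerQubit j → ZMod 2) :=
  rowSpace (gallagerHX j)

/-- **`Z`-check weight `≤ 12`** (`4` from a column of `G`, `8` from a column of `Gᵀ` = a row of `G`).
[cite: TillichZemor2014, Thm 1 (row weights i + j)] -/
theorem card_rowSupp_gallagerHZ_le (j : ℕ) (x : GallagerZCheck j) : (rowSupp (gallagerHZ j) x).card ≤ 12 := by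
  have h := HypergraphProduct.card_rowSupp_zMatrix_le (gallagerMatrix j) (gallagerMatrix j)ᵀ
    (fun α => (gallagerMatrix_spec j).2.2.2.1 α) (fun β => (gallagerMatrix_spec j).2.2.1 β) x
  exact h.trans (by norm_num)

/-- **Distance `≥ j + 2` of the second sector** (TZ Thm 9, cocycle half: `min(d(ker Gᵀ), d(ker (Gᵀ)ᵀ)) =
min(∞, j+2)`). [cite: TillichZemor2014, Thm 1 via Thm 9] -/
theorem le_hammingNorm_of_gallager_cocycle (j : ℕ) (x : GallagerQubit j → ZMod 2) (hx : gallagerHZ j *ᵥ x = 0)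
    (hxS : x ∉ gallagerSX j) : j + 2 ≤ hammingNorm x := by
  have hspec := gallagerMatrix_spec j
  refine HypergraphProduct.le_hammingNorm_of_cocycle _ _ ?_ ?_ x hx hxS
  · rw [pcCode_transpose_eq_bot_of_rank_eq _ (by rw [hspec.1, Fintype.card_fin]), Coding.minDist_bot]
    exact le_top
  · have h := hspec.2.2.2.2
    rw [gallagerN_div] at h
    rw [Matrix.transpose_transpose]
    exact h

/-- Non-vacuity of the second sector: an `X`-type logical exists (`d^X > 0` since `k > 0`).
[cite: TillichZemor2014, Thm 1 via Thm 7 (k² > 0)] -/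
theorem gallager_exists_logical' (j : ℕ) :
    ∃ x : GallagerQubit j → ZMod 2, gallagerHZ j *ᵥ x = 0 ∧ x ∉ gallagerSX j := by
  have hk := gallager_k_pos j
  have hdX : 0 < (gallagerCSS j).dX :=
    Nat.pos_of_ne_zero fun h => (Nat.pos_iff_ne_zero.1 hk) (((gallagerCSS j).k_eq_zero_iff_dX_eq_zero).2 h)
  obtain ⟨v, hv, hv'⟩ := ((gallagerCSS j).dX_pos_iff).1 hdX
  exact ⟨v, hv, hv'⟩

/-- The number of `Z`-checks: `2n_j · r_j ≤ 4 n_j²`. [cite: TillichZemor2014, §4] -/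
theorem card_gallagerZCheck_le (j : ℕ) : Fintype.card (GallagerZCheck j) ≤ 4 * gallagerN j ^ 2 := by
  simp only [Fintype.card_prod, Fintype.card_fin]
  have h := (gallagerMatrix_spec j).2.1
  nlinarith

open Classical in
/-- **Second sector, code capacity**: `484 p(1-p) < 1` ⇒ `Prob_fail → 0` for EVERY family of minimum-weight
decoders of the `H_Z`-detected sector. UNCONDITIONAL. [cite: DumerKovalevPryadko2015, Thm 2 (y = 0; w = 12)] -/
theorem gallagerHGP_codeCapacityThreshold'
    (D : ∀ j, Decoder (GallagerZCheck j → ZMod 2) (GallagerQubit j → ZMod 2))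
    (hD : ∀ j, (D j).IsMinWeight (fun e => gallagerHZ j *ᵥ e) {x | gallagerHZ j *ᵥ x = 0} hammingNorm)
    {p : ℝ} (hp0 : 0 ≤ p) (hp : p ≤ 1 / 2) (h : 484 * (p * (1 - p)) < 1) :
    Tendsto (fun j => ∑ e ∈ univ.filter (fun e : GallagerQubit j → ZMod 2 =>
        ¬ (D j).Corrects (fun e => gallagerHZ j *ᵥ e) (gallagerSX j : Set (GallagerQubit j → ZMod 2)) e),
        bernoulliWeight p (supp e)) atTop (𝓝 0) := by
  refine codeCapacityThreshold_of_rowWeight' gallagerHZ gallagerSX D hD (w := 12) (by norm_num)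
    card_rowSupp_gallagerHZ_le (fun j => j + 2) (fun j => by omega) le_hammingNorm_of_gallager_cocycle ?_ hp0 hp
    (by norm_num; linarith)
  intro r hr0 hr1
  have hl := tendsto_poly_mul_pow' hr0 hr1 (8 * 650 ^ 2) 2
  refine squeeze_zero (fun j => by positivity) (fun j => ?_) hl
  exact mul_le_mul_of_nonneg_right (card_gallagerQubit_le_real j) (pow_nonneg hr0.le _)

/-- **Second sector, erasures**: `11 y < 1` ⇒ uncorrectable-erasure probability `→ 0`. UNCONDITIONAL.
[cite: DumerKovalevPryadko2015, Thm 2 (erasure part; w = 12)] -/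
theorem gallagerHGP_erasureThreshold' {y : ℝ} (hy0 : 0 ≤ y) (hy : 11 * y < 1) :
    Tendsto (fun j => ErasureDecoder.uncorrectableProb {x : GallagerQubit j → ZMod 2 | gallagerHZ j *ᵥ x = 0}
      (gallagerSX j : Set (GallagerQubit j → ZMod 2)) y) atTop (𝓝 0) := by
  refine erasureThreshold_of_rowWeight' gallagerHZ gallagerSX (w := 12) (by norm_num) card_rowSupp_gallagerHZ_le
    (fun j => j + 2) (fun j => by omega) le_hammingNorm_of_gallager_cocycle ?_ hy0 (by norm_num; linarith)
  intro r hr0 hr1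
  have hl := tendsto_poly_mul_pow' hr0 hr1 (8 * 650 ^ 2) 2
  refine squeeze_zero (fun j => by positivity) (fun j => ?_) hl
  exact mul_le_mul_of_nonneg_right (card_gallagerQubit_le_real j) (pow_nonneg hr0.le _)

end Literature.InformationTheory.QuantumCodes
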